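import Mathlib.LinearAlgebra.Eigenspace.Triangularizable
import Mathlib.Analysis.Complex.Polynomial.Basic
import Literature.NumberTheory.Automorphic.LocalLanglandsGLOne
import Literature.NumberTheory.GaloisRepresentations.WeilDeligneRepProofs
import Literature.NumberTheory.GaloisRepresentations.WeilGroupFrobeniusPowers
import Literature.NumberTheory.GaloisRepresentations.LocalClassFieldTheoryGL1Proofs
import Literature.NumberTheory.EllipticCurves.EisensteinNewformLevelRaisingInertiaLFactorProofs
import HarnessLib

/-!
# A non-trivial twisted Euler factor exhibits a `W_F`-stable line in `ker N` (stub L1)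

Stub L1 `stub_exists_line_of_eulerFactor_tprod_ne_one` of line `Sketch_18745_r1_k1` (idea
`reciprocity-rigidity`, rank-2 step) for the crux `DyadicOddResidue.SectorComplement`
(stmt-Langlands-18745).

Let `F` be a non-archimedean local field, `σ = (ρ, N)` a Weil–Deligne representation of `W_F` on a
finite-dimensional complex space `V`, `χ₀` a quasi-character of `Fˣ` and `V₁` a complex line
carrying the Weil–Deligne representation `(χ₀ ∘ artin, 0)` (`WeilDeligneRep.ofQuasiCharOn`).  If
the Euler factor `det(1 - T·Φ | (ker N_{σ ⊗ χ₀})^{I_F})` of the twist `σ ⊗ χ₀` is not `1`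
(Tate, Corvallis 1979, (4.1.6)), then there are a quasi-character `α` of `Fˣ` and a non-zero
vector `v ∈ ker N` with `ρ(w) v = α(artin w) • v` for every `w ∈ W_F`.

Proof.  A non-trivial Euler factor forces `(ker N_{σ⊗χ₀})^{I_F} ≠ 0`
(`Hida2000Thm326.inertiaInvariantsKerN_ne_bot_of_eulerFactor_ne_one`); this finite-dimensional
complex space is stable under a geometric Frobenius `Φ` (`WeilDeligneRep.restrictInertiaInvariantsKerN`),
which therefore has an eigenvector `x` there (`Module.End.exists_eigenvalue`).  The set of
`w ∈ W_F` acting on `x` by a scalar is a subgroup containing `Φ` and `I_F`, hence all of `W_F`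
(`WeilGroup.subgroup_eq_top_of_inertia_le`).  Writing `V ⊗ V₁ ≅ V` (`V₁` is a line spanned by
`e₁`, every tensor is `v ⊗ e₁`), `x = v ⊗ e₁` with `v ≠ 0`, `N v = 0` and `ρ(w) v ∈ ℂ v` for all
`w`; so `ℂ v` is a one-dimensional sub-Weil–Deligne representation of `σ`, isomorphic to
`(α ∘ artin, 0)` for a quasi-character `α` by the one-dimensional case
(`WeilDeligneRep.existsUnique_isEquivalent_ofQuasiChar`: continuity of the character and local
class field theory for `GL₁`, `LocalArtinData.recGL1_bijective_holds`).

## References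

* J. Tate, *Number theoretic background*, Proc. Sympos. Pure Math. XXXIII (Corvallis 1977), Part 2,
  AMS 1979, (1.4.1), (1.4.5), (2.2), (4.1.3), (4.1.6). [TateCorvallis1979]
* P. Deligne, *Les constantes des équations fonctionnelles des fonctions `L`*, Antwerp II,
  LNM 349 (1973), §8.4.1, (8.1.2), §8.12. [DeligneAntwerpII1973]
-/

noncomputable section

set_option linter.dupNamespace false

open scoped TensorProduct
open Module Literature.NumberTheory.Automorphic Literature.NumberTheory.GaloisRepresentations

namespace Summit.Langlands.Langlands.Theorems.ReciprocityRigidity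

variable {F : Type} [Field F] [ValuativeRel F] [TopologicalSpace F] [IsNonarchimedeanLocalField F]

/-- **`W_F = ⟨Φ, I_F⟩` acting on a line.**  For a representation `ρ` of `W_F` and a vector `x`, if a
geometric Frobenius `Φ` (`deg Φ = -1`) and every element of the inertia group act on `x` by a
scalar, then so does every `w ∈ W_F`: the set of such `w` is a subgroup (for the inverse, `ρ(a)` is
invertible, so the scalar of `a` is non-zero unless `x = 0`), and a subgroup containing `Φ` and
`I_F` is everything (`WeilGroup.subgroup_eq_top_of_inertia_le`).
[cite: TateCorvallis1979, (1.4.1)] -/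
theorem exists_smul_eq_of_geomFrob_of_inertia {W : Type*} [AddCommGroup W] [Module ℂ W]
    (ρ : Representation ℂ (WeilGroup F) W) (x : W) {Φ : WeilGroup F} (hΦ : WeilGroup.deg Φ = -1)
    (hΦx : ∃ c : ℂ, ρ Φ x = c • x) (hI : ∀ u ∈ WeilGroup.inertia F, ∃ c : ℂ, ρ u x = c • x)
    (w : WeilGroup F) : ∃ c : ℂ, ρ w x = c • x := by
  let S : Subgroup (WeilGroup F) :=
    { carrier := {a | ∃ c : ℂ, ρ a x = c • x}
      mul_mem' := fun {a b} ha hb => by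
        simp only [Set.mem_setOf_eq] at ha hb ⊢
        obtain ⟨ca, ha⟩ := ha
        obtain ⟨cb, hb⟩ := hb
        exact ⟨cb * ca, by rw [map_mul, Module.End.mul_apply, hb, map_smul, ha, smul_smul]⟩
      one_mem' := by
        simp only [Set.mem_setOf_eq]
        exact ⟨1, by rw [map_one, Module.End.one_apply, one_smul]⟩
      inv_mem' := fun {a} ha => by
        simp only [Set.mem_setOf_eq] at ha ⊢
        obtain ⟨c, hc⟩ := ha
        have hinv : ρ a⁻¹ (ρ a x) = x := by
          rw [← Module.End.mul_apply, ← map_mul, inv_mul_cancel, map_one, Module.End.one_apply]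
        by_cases hc0 : c = 0
        · rw [hc0, zero_smul] at hc
          have hx : x = 0 := by rw [← hinv, hc, map_zero]
          exact ⟨0, by rw [hx, map_zero, smul_zero]⟩
        · have h1 : c • ρ a⁻¹ x = x := by rw [← map_smul, ← hc, hinv]
          exact ⟨c⁻¹, by rw [← inv_smul_smul₀ hc0 (ρ a⁻¹ x), h1]⟩ }
  have hS : S = ⊤ := WeilGroup.subgroup_eq_top_of_inertia_le hΦ hΦx fun u hu => hI u hu
  have hw : w ∈ S := hS ▸ Subgroup.mem_top w
  exact hw

/-- **An eigenvector of Frobenius in `(ker N)^{I_F}`.**  If `(ker N)^{I_F} ≠ 0` (a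
finite-dimensional complex space, stable under every `ρ(w)` since `I_F` is normal —
`WeilDeligneRep.restrictInertiaInvariantsKerN`), then any `Φ ∈ W_F` has an eigenvector there
(`Module.End.exists_eigenvalue`, `ℂ` algebraically closed): a vector `x ≠ 0` with `N x = 0`,
fixed by inertia, and `ρ(Φ) x = μ • x`. [cite: TateCorvallis1979, (4.1.6)] -/
theorem exists_eigenvector_of_inertiaInvariantsKerN_ne_bot (hn : absInertia_normal F)
    {W : Type*} [AddCommGroup W] [Module ℂ W] [FiniteDimensional ℂ W]
    (r : WeilDeligneRep F ℂ W) (h : r.inertiaInvariantsKerN ≠ ⊥) (Φ : WeilGroup F) :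
    ∃ x : W, x ≠ 0 ∧ r.N x = 0 ∧ (∀ u ∈ WeilGroup.inertia F, r.ρ u x = x) ∧
      ∃ μ : ℂ, r.ρ Φ x = μ • x := by
  haveI : Nontrivial r.inertiaInvariantsKerN := Submodule.nontrivial_iff_ne_bot.mpr h
  obtain ⟨μ, hμ⟩ := Module.End.exists_eigenvalue (r.restrictInertiaInvariantsKerN hn Φ)
  obtain ⟨y, hy⟩ := hμ.exists_hasEigenvector
  obtain ⟨hy1, hy0⟩ := Module.End.hasEigenvector_iff.mp hy
  have hmem := (r.mem_inertiaInvariantsKerN_iff y).mp y.2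
  refine ⟨y, fun h0 => hy0 (Submodule.coe_eq_zero.mp h0), hmem.1, hmem.2, μ, ?_⟩
  have key := congrArg Subtype.val (Module.End.mem_eigenspace_iff.mp hy1)
  rwa [WeilDeligneRep.coe_restrictInertiaInvariantsKerN_apply, Submodule.coe_smul] at key

/-- **Untwisting along a line.**  Let `V₁` be a complex line, with basis vector `e₁`, carrying
`(χ₀ ∘ artin, 0)`.  Every element of `V ⊗ V₁` is `v ⊗ e₁` (`V ⊗ V₁ ≅ V ⊗ ℂ ≅ V`), and on such
tensors `N_{σ ⊗ χ₀}(v ⊗ e₁) = N v ⊗ e₁`, `(σ ⊗ χ₀)(w)(v ⊗ e₁) = χ₀(artin w) • ρ(w) v ⊗ e₁`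
(Deligne, Antwerp II, (8.1.2)); hence a non-zero `x ∈ ker N_{σ ⊗ χ₀}` on which every `w ∈ W_F`
acts by a scalar is `v ⊗ e₁` with `v ≠ 0`, `N v = 0` and every `ρ(w) v` a multiple of `v`.
[cite: TateCorvallis1979, (4.1.5)] -/
theorem exists_line_of_tprod_line
    (hns : WeilGroup.exists_subgroup_le_inertia_isOpen_of_continuous (F := F))
    (d : LocalArtinData F) {V : Type*} [AddCommGroup V] [Module ℂ V]
    {V₁ : Type*} [AddCommGroup V₁] [Module ℂ V₁] (hV₁ : finrank ℂ V₁ = 1)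
    (σ : WeilDeligneRep F ℂ V) (χ₀ : QuasiChar F) {x : V ⊗[ℂ] V₁} (hx0 : x ≠ 0)
    (hN : (σ.tprod (WeilDeligneRep.ofQuasiCharOn V₁ hns d χ₀)).N x = 0)
    (hρ : ∀ w : WeilGroup F, ∃ c : ℂ,
      (σ.tprod (WeilDeligneRep.ofQuasiCharOn V₁ hns d χ₀)).ρ w x = c • x) :
    ∃ v : V, v ≠ 0 ∧ σ.N v = 0 ∧ ∀ w : WeilGroup F, ∃ c : ℂ, σ.ρ w v = c • v := by
  classical
  -- the basis vector `e₁` of the line `V₁`, the coordinate `ε : V₁ ≃ ℂ`, and `P (y ⊗ c) = ε c • y`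
  set b : Basis (Fin 1) ℂ V₁ := basisUnique (Fin 1) hV₁ with hb
  set e₁ : V₁ := b 0 with he₁
  set ε : V₁ ≃ₗ[ℂ] ℂ := b.equivFun.trans (LinearEquiv.funUnique (Fin 1) ℂ ℂ) with hε
  have hεe₁ : ε e₁ = 1 := by simp [hε, he₁]
  have hε_smul : ∀ y : V₁, ε y • e₁ = y := fun y => by
    have h := b.sum_equivFun y
    rw [Fin.sum_univ_one] at h
    simpa [hε, he₁] using h
  set P : V ⊗[ℂ] V₁ ≃ₗ[ℂ] V :=
    (TensorProduct.congr (LinearEquiv.refl ℂ V) ε).trans (TensorProduct.rid ℂ V) with hP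
  have hP_tmul : ∀ (y : V) (c : V₁), P (y ⊗ₜ c) = ε c • y := fun y c => by
    simp [hP, TensorProduct.congr_tmul, TensorProduct.rid_tmul]
  have hPe : ∀ y : V, P (y ⊗ₜ e₁) = y := fun y => by rw [hP_tmul, hεe₁, one_smul]
  -- every tensor is `P z ⊗ e₁`
  have hsurj : ∀ z : V ⊗[ℂ] V₁, z = P z ⊗ₜ e₁ := by
    intro z
    induction z using TensorProduct.induction_on with
    | zero => simp
    | tmul y c => rw [hP_tmul, TensorProduct.smul_tmul, hε_smul]
    | add z z' hz hz' => rw [map_add, TensorProduct.add_tmul, ← hz, ← hz']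
  refine ⟨P x, fun h0 => hx0 (by rw [hsurj x, h0, TensorProduct.zero_tmul]), ?_, fun w => ?_⟩
  · -- `N (v ⊗ e₁) = N v ⊗ e₁`
    rw [hsurj x, WeilDeligneRep.tprod_N, LinearMap.add_apply, TensorProduct.map_tmul,
      TensorProduct.map_tmul, WeilDeligneRep.ofQuasiCharOn_N, LinearMap.zero_apply,
      TensorProduct.tmul_zero, add_zero, Module.End.one_apply] at hN
    rw [← hPe (σ.N (P x)), hN, map_zero]
  · -- `(σ ⊗ χ₀)(w)(v ⊗ e₁) = ρ(w) v ⊗ χ₀(artin w) e₁`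
    obtain ⟨c, hc⟩ := hρ w
    rw [hsurj x, WeilDeligneRep.tprod_ρ_apply, TensorProduct.map_tmul,
      WeilDeligneRep.ofQuasiCharOn_ρ_apply] at hc
    have hc' := congrArg P hc
    rw [hP_tmul, map_smul ε, hεe₁, map_smul P, hPe, smul_eq_mul, mul_one] at hc'
    refine ⟨((χ₀ (d.artin w) : ℂˣ) : ℂ)⁻¹ * c, ?_⟩
    rw [← smul_smul, ← hc', inv_smul_smul₀ (Units.ne_zero _)]

/-- **A `W_F`-stable line in `ker N` is a quasi-character twist.**  If `v ≠ 0`, `N v = 0` and every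
`ρ(w) v` is a multiple of `v`, then `ℂ v` is a one-dimensional sub-Weil–Deligne representation of
`σ` (`WeilDeligneRep.ofSubrep`), hence isomorphic to `(α ∘ artin, 0)` for a quasi-character `α` of
`Fˣ` (`WeilDeligneRep.existsUnique_isEquivalent_ofQuasiChar`: the character of `W_F` on the line is
continuous and factors through the Artin map by local class field theory for `GL₁`); reading the
isomorphism on `v` gives `ρ(w) v = α(artin w) • v`. [cite: TateCorvallis1979, (1.4.5)] -/
theorem exists_quasiChar_of_forall_exists_smul
    (hns : WeilGroup.exists_subgroup_le_inertia_isOpen_of_continuous (F := F))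
    (d : LocalArtinData F) {V : Type*} [AddCommGroup V] [Module ℂ V]
    (σ : WeilDeligneRep F ℂ V) {v : V} (hv : v ≠ 0) (hN : σ.N v = 0)
    (hρ : ∀ w : WeilGroup F, ∃ c : ℂ, σ.ρ w v = c • v) :
    ∃ α : QuasiChar F, ∀ w : WeilGroup F, σ.ρ w v = ((α (d.artin w) : ℂˣ) : ℂ) • v := by
  set L : Submodule ℂ V := ℂ ∙ v with hL
  have hvL : v ∈ L := Submodule.mem_span_singleton_self v
  have hsub : σ.IsSubrep L := by
    refine ⟨fun w y hy => ?_, fun y hy => ?_⟩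
    · rw [Submodule.mem_comap]
      obtain ⟨a, rfl⟩ := Submodule.mem_span_singleton.mp hy
      obtain ⟨c, hc⟩ := hρ w
      rw [map_smul, hc, smul_smul]
      exact L.smul_mem _ hvL
    · rw [Submodule.mem_comap]
      obtain ⟨a, rfl⟩ := Submodule.mem_span_singleton.mp hy
      rw [map_smul, hN, smul_zero]
      exact L.zero_mem
  have h1 : finrank ℂ L = 1 := finrank_span_singleton hv
  obtain ⟨α, ⟨e⟩, -⟩ :=
    WeilDeligneRep.existsUnique_isEquivalent_ofQuasiChar hns d (σ.ofSubrep L hsub) h1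
  refine ⟨α, fun w => ?_⟩
  set φ : L ≃ₗ[ℂ] ℂ := e.toRepEquiv.toLinearEquiv with hφ
  have hφρ : ∀ (w : WeilGroup F) (y : L),
      φ ((σ.ofSubrep L hsub).ρ w y) = (WeilDeligneRep.ofQuasiChar hns d α).ρ w (φ y) := fun w y => by
    rw [hφ, Representation.Equiv.toLinearEquiv_apply, Representation.Equiv.toLinearEquiv_apply]
    exact Representation.IntertwiningMap.isIntertwining _ _ e.toRepEquiv.toIntertwiningMap w y
  have key : φ ((σ.ofSubrep L hsub).ρ w ⟨v, hvL⟩) = φ (((α (d.artin w) : ℂˣ) : ℂ) • ⟨v, hvL⟩) := by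
    rw [hφρ, WeilDeligneRep.ofQuasiChar_ρ_apply, map_smul, smul_eq_mul]
  have key' := φ.injective key
  have hcoe : (((σ.ofSubrep L hsub).ρ w ⟨v, hvL⟩ : L) : V) = σ.ρ w v := rfl
  rw [← hcoe, key', Submodule.coe_smul]

/-- **Stub L1: a non-trivial twisted Euler factor exhibits a stable line in `ker N`.**  If the
Euler factor `det(1 - T·Φ | (ker N)^{I_F})` (Tate, Corvallis 1979, (4.1.6)) of the twist
`σ ⊗ (χ₀ ∘ artin)` of a Weil–Deligne representation `σ = (ρ, N)` by a quasi-character `χ₀`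
(realised on any complex line `V₁`) is not `1`, then some non-zero `v ∈ ker N` spans a
`W_F`-stable line on which `W_F` acts through `α ∘ artin` for a quasi-character `α` of `Fˣ`:
`(ker N_{σ⊗χ₀})^{I_F} ≠ 0` carries an eigenvector of a geometric Frobenius, on which all of
`W_F = ⟨Φ, I_F⟩` acts by scalars; untwisting along `V ⊗ V₁ ≅ V` and the one-dimensional case
(local class field theory for `GL₁`) give `α`. [cite: TateCorvallis1979, (4.1.6)] -/
theorem stub_exists_line_of_eulerFactor_tprod_ne_one (hn : absInertia_normal F)
    (hex : @exists_isFrobPow F _ _ _ _)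
    (hns : @WeilGroup.exists_subgroup_le_inertia_isOpen_of_continuous F _ _ _ _)
    (d : LocalArtinData F)
    {V : Type*} [AddCommGroup V] [Module ℂ V] [FiniteDimensional ℂ V]
    {V₁ : Type*} [AddCommGroup V₁] [Module ℂ V₁] [FiniteDimensional ℂ V₁] (hV₁ : finrank ℂ V₁ = 1)
    (σ : WeilDeligneRep F ℂ V) (χ₀ : QuasiChar F)
    (h : (σ.tprod (WeilDeligneRep.ofQuasiCharOn V₁ hns d χ₀)).eulerFactor hn hex ≠ 1) :
    ∃ (α : QuasiChar F) (v : V), v ≠ 0 ∧ σ.N v = 0 ∧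
      ∀ w : WeilGroup F, σ.ρ w v = ((α (d.artin w) : ℂˣ) : ℂ) • v := by
  have hbot := Literature.NumberTheory.EllipticCurves.Hida2000Thm326.inertiaInvariantsKerN_ne_bot_of_eulerFactor_ne_one
    _ hn hex h
  obtain ⟨x, hx0, hxN, hxI, μ, hxΦ⟩ :=
    exists_eigenvector_of_inertiaInvariantsKerN_ne_bot hn _ hbot (WeilDeligneRep.geomFrob F hex)
  have hρx : ∀ w : WeilGroup F, ∃ c : ℂ,
      (σ.tprod (WeilDeligneRep.ofQuasiCharOn V₁ hns d χ₀)).ρ w x = c • x :=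
    exists_smul_eq_of_geomFrob_of_inertia _ x (WeilDeligneRep.deg_geomFrob' hex) ⟨μ, hxΦ⟩
      fun u hu => ⟨1, by rw [hxI u hu, one_smul]⟩
  obtain ⟨v, hv0, hvN, hvρ⟩ := exists_line_of_tprod_line hns d hV₁ σ χ₀ hx0 hxN hρx
  obtain ⟨α, hα⟩ := exists_quasiChar_of_forall_exists_smul hns d σ hv0 hvN hvρ
  exact ⟨α, v, hv0, hvN, hα⟩

end Summit.Langlands.Langlands.Theorems.ReciprocityRigidity

end
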